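import Mathlib.NumberTheory.NumberField.Basic
import Mathlib.LinearAlgebra.Dimension.Finrank
import Literature.AlgebraicGeometry.Motives.Varieties
import Literature.AlgebraicGeometry.Motives.AlgPoints
import Literature.AlgebraicGeometry.Motives.BettiRealization
import HarnessLib

-- D-0014 sorry-sweep (operator, 2026-08-13): sorried theorems -> named facts `def X : Prop`; partial proofs preserved in comments
-- provenance: harness21/H21/H21/Statements/Abc/Sweep1.lean @ 5b06834 (interim HEAD d8f2665); M5 mechanical rewrite
/-!
# abc family, statement sweep 1: Faltings' theorem (Mordell conjecture)

Family `abc`, statements swept in this round: **abc.S14** (covered), `abc.S23` (not covered).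

## abc.S14 — Faltings' theorem

*A smooth projective curve of genus `≥ 2` over a number field `K` has only finitely many
`K`-rational points* (G. Faltings, *Endlichkeitssätze für abelsche Varietäten über Zahlkörpern*,
Invent. Math. 73 (1983), Satz 7; the abc conjecture over `K` gives an *effective* bound for the
height of these points, N. Elkies, *ABC implies Mordell*, IMRN 1991, no. 7).

We state Faltings' finiteness theorem against the accepted `MotiveAbstract` vocabulary:

* a *curve over `K`* is a `K`-scheme `X : Literature.SchemeOver K` with `Literature.IsSmoothProjective 1 X`
  (smooth of relative dimension `1`, projective, geometrically irreducible);
* its `K`-points are `Literature.AlgPoints X K` (`K`-morphisms `Spec K ⟶ X`);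
* its **genus** is defined topologically, `g(X) = ½ · dim_ℚ H¹(X(ℂ); ℚ)`, through the accepted
  Betti cohomology `Literature.bettiCohomology X 1` of the complex points for a chosen embedding
  `K ⊆ ℂ` (an `[Algebra K ℂ]` argument; every number field has one, Mathlib
  `NumberField.Embeddings.card`). For a smooth projective geometrically irreducible curve this is
  the geometric genus `dim H⁰(X, Ω¹) = dim H¹(X, 𝒪_X)` and is independent of the embedding
  (Griffiths–Harris, *Principles of Algebraic Geometry*, §2.1; Hartshorne IV.1 and App. B.3);
  Mathlib has no sheaf cohomology of coherent sheaves and no genus of a scheme (grep `genus` in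
  `Mathlib/AlgebraicGeometry`: nothing), so the Betti route is the only real definition available.

The Elkies refinement "abc over `K` ⟹ an *effectively computable* bound on the height of the
points of `X(K)`" is **not** stated: it needs Weil heights on `X(K̄)` attached to a divisor /
projective embedding of a curve (H21 has heights only on `ℙⁿ(K)` via Mathlib `Height.logHeight`
and on elliptic curves), and a formal notion of "effectively computable constant".

## abc.S23 — Vojta's main conjecture (NOT covered)

Missing notions: Weil height `h_D` attached to a Cartier divisor (height machine up to `O(1)`),
local heights / proximity function `m_S(D, P) = ∑_{v ∈ S} λ_{D,v}(P)`, normal-crossings divisors,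
the canonical divisor class `K_X` and ampleness on an `Literature.SchemeOver k`. None of these exists in
Mathlib or in the H21 prelude (`vojta_height_machinery` in the gap inventory); each is far more
than routine glue.

## Design notes

* `noncomputable section`, namespace `Literature.Abc`; universe `0` throughout (forced by
  `Literature.AlgebraicGeometry.Motives.ComplexPoints`, see `Literature.Prelude.MotiveAbstract.BettiRealization`).
* Faltings' theorem is a theorem in print, hence `theorem … := by sorry`.

## References

* G. Faltings, *Endlichkeitssätze für abelsche Varietäten über Zahlkörpern*, Invent. Math. 73
  (1983), 349–366, Satz 7.
* N. D. Elkies, *ABC implies Mordell*, Int. Math. Res. Notices 1991, no. 7, 99–109.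
* R. Hartshorne, *Algebraic Geometry*, IV.1, Appendix B.3.
-/

noncomputable section

open CategoryTheory AlgebraicGeometry

namespace Literature.NumberTheory.DiophantineGeometry

variable {K : Type} [Field K]

/-- The (topological) **genus** of a `K`-scheme `X` for a field `K ⊆ ℂ`:
`g(X) = ½ · dim_ℚ H¹(X(ℂ); ℚ)`, half the first Betti number of the complex points with the
analytic topology (`Literature.bettiCohomology X 1`). For a smooth projective geometrically irreducible
curve this is the usual genus `dim H⁰(X, Ω¹_X)` (Griffiths–Harris, *Principles of Algebraic
Geometry*, §2.1; Hartshorne, *Algebraic Geometry*, IV.1 and App. B.3). Junk value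
(`Module.finrank = 0`, natural-number division) when `H¹` is infinite-dimensional or odd-dimensional,
which does not happen for smooth projective curves. [folklore] -/
def genus [Algebra K ℂ] (X : Literature.AlgebraicGeometry.Motives.SchemeOver K) : ℕ :=
  Module.finrank ℚ (Literature.AlgebraicGeometry.Motives.bettiCohomology X 1) / 2

/-- **abc.S14** (Faltings' theorem = Mordell's conjecture; G. Faltings, *Endlichkeitssätze für
abelsche Varietäten über Zahlkörpern*, Invent. Math. 73 (1983), Satz 7: "jede glatte projektive
algebraische Kurve `X` vom Geschlecht `g ≥ 2` über einem Zahlkörper `K` hat nur endlich viele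
`K`-rationale Punkte `X(K)`", as summarised in Zbl 0588.14026). Let `K` be a number field (with a
chosen complex embedding, used only to compute the genus) and `X` a smooth projective
geometrically irreducible curve over `K` of genus `g(X) ≥ 2`. Then the set `X(K)` of `K`-rational
points is finite.

Citation note: the earlier machine tag on this fact pointed at N. D. Elkies, *ABC implies
Mordell*, Int. Math. Res. Notices 1991, no. 7, 99–109 (bib key `Elkies1991ABCMordell`,
Zbl 0763.11016), which proves only the *conditional* statement "the abc conjecture over `K`
implies Mordell's conjecture over `K`, with an effective height bound"; the unconditional
finiteness stated here is Faltings' Satz 7, so the tag now names that source. The statement is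
unchanged. [cite: Faltings1983Endlichkeit, Satz 7] -/
def finite_algPoints_of_two_le_genus : Prop :=
  ∀ [NumberField K] [Algebra K ℂ] (X : Literature.AlgebraicGeometry.Motives.SchemeOver K) (hX : Literature.AlgebraicGeometry.Motives.IsSmoothProjective 1 X) (hg : 2 ≤ genus X),
    Finite (Literature.AlgebraicGeometry.Motives.AlgPoints X K)

end Literature.NumberTheory.DiophantineGeometry
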